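import Literature.NumberTheory.Rogawski1990.ArchInnerTransferCongruence          -- ★ (T-d) FILE 2: `isStablyConj_archCongr_iff` (abstract congruence frame)
import Literature.NumberTheory.Automorphic.ArchCongruenceOrbitalTransport          -- ★ (T-d) FILE 1: `forall_archCongr_mem_centralizer_iff`
import Literature.NumberTheory.Rogawski1990.ArchEndoscopicCurveRegularCompact       -- ★ p841630 (3R-G′): `isCompact_centralizer_singleton_of_isConj`; brings ★ (V8), ★ `isCompact_centralizer_archDiagTorus`
import Literature.NumberTheory.Automorphic.UnitaryGroupArchimedean                 -- ★ `isCompact_arch_cm` (totally definite ⇒ compact)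
import HarnessLib

/-!
# The `H_∞`-side compact centralisers along the torus: every element of `H_∞ = U(Φ₂)_∞ × U(Φ₁)_∞` stably conjugate to a point whose 2-block is congruent to a regular torus point
# has a COMPACT centraliser (R3 STEP 3 node (3R), `H`-side = the `hZH` binder of ★ `ArchDeltaTransferHaarForm`; Rogawski 1990 §3.1, §14.3 p. 234)

Topic `NumberTheory/Rogawski1990`; namespace `Literature.NumberTheory.Rogawski1990`.  THEOREMS ONLY (no `def`, no instance, no notation, no axiom, no named fact, no `sorry`).
Cell `pub/hodgecm-mathlib`, ENGINE T1 (crux H413 = `stmt-HodgeConjecture-24833`); ROAD-Sd residual R3 «(S-c) central vanishing» (`stub_ScCore`), STEP 3 node (3R) `H`-side of the integration census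
`CENSUS-R3-STEP3-Integration` b54b3c40 (pen of record F0P3a-p03 (g10), LEAD WORDS T8-76 (C) ∕ T8-79 (1)); sequel of ★ p841630 (the `G′`-side).

THE STATEMENT.  Fix a diagonal 2-block `α` (`α_i ≠ 0`, `c(α_i) = α_i`) and ANY congruence `Ψ : U(Φ₂)(L ⊗ ℝ) ≃ₜ* U(diag α)(L ⊗ ℝ)` of the (T-d) abstract frame (`Ψ g = T g T⁻¹`; e.g. ★ (R3-a)'s
`Φ₂ = c(Q₂)ᵀ·diag(½,−½)·Q₂`, the frame of F0P3a-p02 (g11)'s (3H)).  If `x ∈ H_∞` has 2-block `x.1` with `Ψ x.1 = t(u)` a REGULAR torus point (`u_w 0 ≠ u_w 1`), then every `a ∼_stH x`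
(★ `IsArchStablyConjH`: componentwise stable conjugacy) has a compact centraliser in `H_∞`:
`Z_{H_∞}(a) = Z(a.1) × U(Φ₁)_∞` (★ `centralizer_pair_eq_prod_top_of_comm`-pattern, `U(Φ₁)_∞` abelian), `U(Φ₁)_∞` is compact (totally definite rank one, ★ `isCompact_arch_cm`), and `Z(a.1) ≅ Z(Ψ a.1)`
with `Ψ a.1` stably conjugate to `t(u)` (★ FILE 2 `isStablyConj_archCongr_iff`), hence conjugate to a relabelled torus point (★ (V8)), whose centraliser is compact (★ `isCompact_centralizer_archDiagTorus`,
★ `isCompact_centralizer_singleton_of_isConj`).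
HONEST LABEL: HC_CM is proved only modulo the 7 printed citations until rung 0 closes; this file is bookkeeping and pays nothing by itself.

## References
* [Rogawski1990] J. D. Rogawski, *Automorphic Representations of Unitary Groups in Three Variables*, Ann. of Math. Stud. 123 (1990), §3.1 p. 19, §14.3 p. 234, §14.5 p. 238.
* [PlatonovRapinchuk1994] V. Platonov, A. Rapinchuk, *Algebraic Groups and Number Theory* (1994), §3.2 Thm 3.1 (anisotropic at infinity ⇒ compact), §2.3.
* [BrockerTomDieck1985] T. Bröcker, T. tom Dieck, *Representations of Compact Lie Groups* (1985), Ch. IV (3.1).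
-/

set_option autoImplicit false

noncomputable section

open NumberField NumberField.InfinitePlace Matrix Topology
open Literature.NumberTheory.Automorphic Literature.NumberTheory.Automorphic.UnitaryGroup
open scoped MatrixGroups ComplexOrder

namespace Literature.NumberTheory.Rogawski1990

section HSide

variable (L : Type) [Field L] [NumberField L] [IsCMField L]

/-- `U(Φ₁)(L ⊗ ℝ) = ∏_{w} U(1)` is ABELIAN (`1 × 1` matrices commute). [folklore] [cite: Rogawski1990, §4.2] -/
theorem arch_one_antidiagOne_mul_comm
    (a b : ↥(UnitaryGroup.arch (↥(maximalRealSubfield L)) L (IsCMField.complexConj L) 1 (Matrix.of fun i j : Fin 1 => if i.val + j.val + 1 = 1 then (1 : L) else 0))) :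
    a * b = b * a := by
  apply Subtype.ext
  apply Units.ext
  refine Matrix.ext fun i j => ?_
  fin_cases i; fin_cases j
  simp only [Subgroup.coe_mul, Units.val_mul, Matrix.mul_apply, Fin.sum_univ_one, Fin.zero_eta, Fin.isValue]
  exact mul_comm _ _

omit [NumberField L] [IsCMField L] in
/-- The `1 × 1` antidiagonal-ones form IS the identity form, so it is totally definite. [folklore] [cite: PlatonovRapinchuk1994, §3.2 Thm 3.1] -/
theorem antidiagOne_one_eq_one : (Matrix.of fun i j : Fin 1 => if i.val + j.val + 1 = 1 then (1 : L) else 0) = 1 := by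
  ext i j
  fin_cases i; fin_cases j
  rfl

/-- **`U(Φ₁)(L ⊗ ℝ)` IS COMPACT** (★ `isCompact_arch_cm`: the form `Φ₁ = (1)` is positive definite at every complex place). [cite: PlatonovRapinchuk1994, §3.2 Thm 3.1] -/
theorem compactSpace_arch_one_antidiagOne :
    CompactSpace ↥(UnitaryGroup.arch (↥(maximalRealSubfield L)) L (IsCMField.complexConj L) 1 (Matrix.of fun i j : Fin 1 => if i.val + j.val + 1 = 1 then (1 : L) else 0)) := by
  refine isCompact_iff_compactSpace.1 (isCompact_arch_cm (N := 1) (L := L) (H := _) fun w => Or.inl ?_)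
  rw [antidiagOne_one_eq_one, Matrix.map_one _ (map_zero _) (map_one _)]
  exact Matrix.PosDef.one

/-- In `H_∞ = U(Φ₂)_∞ × U(Φ₁)_∞` the centraliser of `(a₂, a₁)` is `Z(a₂) ×ˢ U(Φ₁)_∞` (the second factor is abelian). [cite: Rogawski1990, §4.2; §14.3 p. 234] -/
theorem coe_centralizer_archH_eq_prod (a : (↥(UnitaryGroup.arch (↥(maximalRealSubfield L)) L (IsCMField.complexConj L) 2 (Matrix.of fun i j : Fin 2 => if i.val + j.val + 1 = 2 then (1 : L) else 0)) × ↥(UnitaryGroup.arch (↥(maximalRealSubfield L)) L (IsCMField.complexConj L) 1 (Matrix.of fun i j : Fin 1 => if i.val + j.val + 1 = 1 then (1 : L) else 0)))) :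
    ((Subgroup.centralizer ({a} : Set (↥(UnitaryGroup.arch (↥(maximalRealSubfield L)) L (IsCMField.complexConj L) 2 (Matrix.of fun i j : Fin 2 => if i.val + j.val + 1 = 2 then (1 : L) else 0)) × ↥(UnitaryGroup.arch (↥(maximalRealSubfield L)) L (IsCMField.complexConj L) 1 (Matrix.of fun i j : Fin 1 => if i.val + j.val + 1 = 1 then (1 : L) else 0)))) : Subgroup (↥(UnitaryGroup.arch (↥(maximalRealSubfield L)) L (IsCMField.complexConj L) 2 (Matrix.of fun i j : Fin 2 => if i.val + j.val + 1 = 2 then (1 : L) else 0)) × ↥(UnitaryGroup.arch (↥(maximalRealSubfield L)) L (IsCMField.complexConj L) 1 (Matrix.of fun i j : Fin 1 => if i.val + j.val + 1 = 1 then (1 : L) else 0)))) : Set (↥(UnitaryGroup.arch (↥(maximalRealSubfield L)) L (IsCMField.complexConj L) 2 (Matrix.of fun i j : Fin 2 => if i.val + j.val + 1 = 2 then (1 : L) else 0)) × ↥(UnitaryGroup.arch (↥(maximalRealSubfield L)) L (IsCMField.complexConj L) 1 (Matrix.of fun i j : Fin 1 => if i.val + j.val + 1 = 1 then (1 : L)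 else 0)))) =
      ((Subgroup.centralizer ({a.1} : Set ↥(UnitaryGroup.arch (↥(maximalRealSubfield L)) L (IsCMField.complexConj L) 2 (Matrix.of fun i j : Fin 2 => if i.val + j.val + 1 = 2 then (1 : L) else 0))) : Subgroup ↥(UnitaryGroup.arch (↥(maximalRealSubfield L)) L (IsCMField.complexConj L) 2 (Matrix.of fun i j : Fin 2 => if i.val + j.val + 1 = 2 then (1 : L) else 0))) : Set ↥(UnitaryGroup.arch (↥(maximalRealSubfield L)) L (IsCMField.complexConj L) 2 (Matrix.of fun i j : Fin 2 => if i.val + j.val + 1 = 2 then (1 : L) else 0))) ×ˢ (Set.univ : Set ↥(UnitaryGroup.arch (↥(maximalRealSubfield L)) L (IsCMField.complexConj L) 1 (Matrix.of fun i j : Fin 1 => if i.val + j.val + 1 = 1 then (1 : L) else 0))) := by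
  ext p
  simp only [SetLike.mem_coe, Subgroup.mem_centralizer_singleton_iff, Set.mem_prod, Set.mem_univ, and_true, Prod.ext_iff, Prod.fst_mul, Prod.snd_mul]
  exact ⟨fun h => h.1, fun h => ⟨h, arch_one_antidiagOne_mul_comm L _ _⟩⟩

variable {N : ℕ} {H H₂ : Matrix (Fin N) (Fin N) L}
  (Ψ : UnitaryGroup.arch (↥(maximalRealSubfield L)) L (IsCMField.complexConj L) N H₂ ≃ₜ* UnitaryGroup.arch (↥(maximalRealSubfield L)) L (IsCMField.complexConj L) N H)

/-- Compactness of a centraliser is carried by a congruence `Ψ` (`Z(a) = Ψ⁻¹(Z(Ψ a))`, ★ FILE 1 `forall_archCongr_mem_centralizer_iff`). [cite: PlatonovRapinchuk1994, §2.3] -/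
theorem isCompact_centralizer_of_isCompact_centralizer_archCongr (a : ↥(UnitaryGroup.arch (↥(maximalRealSubfield L)) L (IsCMField.complexConj L) N H₂))
    (h : IsCompact ((Subgroup.centralizer ({Ψ a} : Set ↥(UnitaryGroup.arch (↥(maximalRealSubfield L)) L (IsCMField.complexConj L) N H)) : Subgroup ↥(UnitaryGroup.arch (↥(maximalRealSubfield L)) L (IsCMField.complexConj L) N H)) : Set ↥(UnitaryGroup.arch (↥(maximalRealSubfield L)) L (IsCMField.complexConj L) N H))) :
    IsCompact ((Subgroup.centralizer ({a} : Set ↥(UnitaryGroup.arch (↥(maximalRealSubfield L)) L (IsCMField.complexConj L) N H₂)) : Subgroup ↥(UnitaryGroup.arch (↥(maximalRealSubfield L)) L (IsCMField.complexConj L) N H₂)) : Set ↥(UnitaryGroup.arch (↥(maximalRealSubfield L)) L (IsCMField.complexConj L) N H₂)) := by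
  have hset : ((Subgroup.centralizer ({a} : Set ↥(UnitaryGroup.arch (↥(maximalRealSubfield L)) L (IsCMField.complexConj L) N H₂)) : Subgroup ↥(UnitaryGroup.arch (↥(maximalRealSubfield L)) L (IsCMField.complexConj L) N H₂)) : Set ↥(UnitaryGroup.arch (↥(maximalRealSubfield L)) L (IsCMField.complexConj L) N H₂)) =
      Ψ ⁻¹' ((Subgroup.centralizer ({Ψ a} : Set ↥(UnitaryGroup.arch (↥(maximalRealSubfield L)) L (IsCMField.complexConj L) N H)) : Subgroup ↥(UnitaryGroup.arch (↥(maximalRealSubfield L)) L (IsCMField.complexConj L) N H)) : Set ↥(UnitaryGroup.arch (↥(maximalRealSubfield L)) L (IsCMField.complexConj L) N H)) := by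
    ext g
    exact ((forall_archCongr_mem_centralizer_iff L Ψ rfl g)).symm
  rw [hset]
  exact Ψ.toHomeomorph.isCompact_preimage.2 h

variable {α : Fin 2 → L} (T : GL (Fin 2) (mixedEmbedding.mixedSpace L))
  (Ψ₂ : UnitaryGroup.arch (↥(maximalRealSubfield L)) L (IsCMField.complexConj L) 2 (Matrix.of fun i j : Fin 2 => if i.val + j.val + 1 = 2 then (1 : L) else 0) ≃ₜ*
    UnitaryGroup.arch (↥(maximalRealSubfield L)) L (IsCMField.complexConj L) 2 (Matrix.diagonal α))
  (hΨ₂ : ∀ g : UnitaryGroup.arch (↥(maximalRealSubfield L)) L (IsCMField.complexConj L) 2 (Matrix.of fun i j : Fin 2 => if i.val + j.val + 1 = 2 then (1 : L) else 0),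
    ((Ψ₂ g : UnitaryGroup.arch (↥(maximalRealSubfield L)) L (IsCMField.complexConj L) 2 (Matrix.diagonal α)) : GL (Fin 2) (mixedEmbedding.mixedSpace L)) =
      T * (g : GL (Fin 2) (mixedEmbedding.mixedSpace L)) * T⁻¹)

include hΨ₂ in
/-- **THE 2-BLOCK**: if `Ψ x₂ = t(u)` is a regular torus point, every `a₂ ∼_st x₂` in `U(Φ₂)(L ⊗ ℝ)` has a compact centraliser (★ FILE 2 `isStablyConj_archCongr_iff`, ★ (V8), ★
`isCompact_centralizer_archDiagTorus`, ★ `isCompact_centralizer_singleton_of_isConj`, then back along `Ψ`). [cite: Rogawski1990, §3.1 p. 19; §14.3 p. 234] -/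
theorem isCompact_centralizer_of_isStablyConj_of_archCongr_eq_archDiagTorus (hα : ∀ i, α i ≠ 0) (hherm : ∀ i, (IsCMField.complexConj L (α i) : L) = α i)
    {x₂ : UnitaryGroup.arch (↥(maximalRealSubfield L)) L (IsCMField.complexConj L) 2 (Matrix.of fun i j : Fin 2 => if i.val + j.val + 1 = 2 then (1 : L) else 0)}
    {u : {w : InfinitePlace L // IsComplex w} → Fin 2 → Circle} (hx : Ψ₂ x₂ = UnitaryGroup.archDiagTorus L 2 α u) (hu : ∀ w, Function.Injective (u w))
    (a₂ : UnitaryGroup.arch (↥(maximalRealSubfield L)) L (IsCMField.complexConj L) 2 (Matrix.of fun i j : Fin 2 => if i.val + j.val + 1 = 2 then (1 : L) else 0))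
    (ha : IsStablyConj (UnitaryGroup.conjMixed (↥(maximalRealSubfield L)) L (IsCMField.complexConj L))
      (UnitaryGroup.archFormOf L 2 (Matrix.of fun i j : Fin 2 => if i.val + j.val + 1 = 2 then (1 : L) else 0)) x₂ a₂) :
    IsCompact ((Subgroup.centralizer ({a₂} : Set ↥(UnitaryGroup.arch (↥(maximalRealSubfield L)) L (IsCMField.complexConj L) 2 (Matrix.of fun i j : Fin 2 => if i.val + j.val + 1 = 2 then (1 : L) else 0))) : Subgroup ↥(UnitaryGroup.arch (↥(maximalRealSubfield L)) L (IsCMField.complexConj L) 2 (Matrix.of fun i j : Fin 2 => if i.val + j.val + 1 = 2 then (1 : L) else 0))) : Set ↥(UnitaryGroup.arch (↥(maximalRealSubfield L)) L (IsCMField.complexConj L) 2 (Matrix.of fun i j : Fin 2 => if i.val + j.val + 1 = 2 then (1 : L) else 0))) := by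
  have hst : IsStablyConj (UnitaryGroup.conjMixed (↥(maximalRealSubfield L)) L (IsCMField.complexConj L)) (UnitaryGroup.archFormOf L 2 (Matrix.diagonal α))
      (UnitaryGroup.archDiagTorus L 2 α u) (Ψ₂ a₂) := by
    rw [← hx]
    exact (isStablyConj_archCongr_iff L T Ψ₂ hΨ₂ x₂ a₂).2 ha
  obtain ⟨ρ, hρ⟩ := exists_isConj_archDiagTorus_of_isStablyConj_of_conj L 2 α hα hherm u (Ψ₂ a₂) hst
  exact isCompact_centralizer_of_isCompact_centralizer_archCongr L Ψ₂ a₂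
    (isCompact_centralizer_singleton_of_isConj hρ (isCompact_centralizer_archDiagTorus L 2 α hα fun w => (hu w).comp (ρ w).injective))

include hΨ₂ in
/-- **THE `hZH` BINDER OF ★ (E1)**: if `x ∈ H_∞` has 2-block congruent to a regular torus point, every `a ∼_stH x` has a COMPACT centraliser in `H_∞` (2-block as above × the compact abelian
`U(Φ₁)_∞`). [cite: Rogawski1990, §14.3 p. 234; §14.5 p. 238] [cite: PlatonovRapinchuk1994, §3.2 Thm 3.1] -/
theorem compactSpace_centralizer_of_isArchStablyConjH_of_archCongr_eq_archDiagTorus (hα : ∀ i, α i ≠ 0) (hherm : ∀ i, (IsCMField.complexConj L (α i) : L) = α i)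
    {x : ↥(UnitaryGroup.arch (↥(maximalRealSubfield L)) L (IsCMField.complexConj L) 2 (Matrix.of fun i j : Fin 2 => if i.val + j.val + 1 = 2 then (1 : L) else 0)) ×
      ↥(UnitaryGroup.arch (↥(maximalRealSubfield L)) L (IsCMField.complexConj L) 1 (Matrix.of fun i j : Fin 1 => if i.val + j.val + 1 = 1 then (1 : L) else 0))}
    {u : {w : InfinitePlace L // IsComplex w} → Fin 2 → Circle} (hx : Ψ₂ x.1 = UnitaryGroup.archDiagTorus L 2 α u) (hu : ∀ w, Function.Injective (u w))
    (a : ↥(UnitaryGroup.arch (↥(maximalRealSubfield L)) L (IsCMField.complexConj L) 2 (Matrix.of fun i j : Fin 2 => if i.val + j.val + 1 = 2 then (1 : L) else 0)) ×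
      ↥(UnitaryGroup.arch (↥(maximalRealSubfield L)) L (IsCMField.complexConj L) 1 (Matrix.of fun i j : Fin 1 => if i.val + j.val + 1 = 1 then (1 : L) else 0)))
    (ha : IsArchStablyConjH L x a) :
    CompactSpace (Subgroup.centralizer ({a} : Set (↥(UnitaryGroup.arch (↥(maximalRealSubfield L)) L (IsCMField.complexConj L) 2 (Matrix.of fun i j : Fin 2 => if i.val + j.val + 1 = 2 then (1 : L) else 0)) ×
      ↥(UnitaryGroup.arch (↥(maximalRealSubfield L)) L (IsCMField.complexConj L) 1 (Matrix.of fun i j : Fin 1 => if i.val + j.val + 1 = 1 then (1 : L) else 0))))) := by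
  haveI := compactSpace_arch_one_antidiagOne L
  refine isCompact_iff_compactSpace.1 ?_
  rw [coe_centralizer_archH_eq_prod]
  exact (isCompact_centralizer_of_isStablyConj_of_archCongr_eq_archDiagTorus L T Ψ₂ hΨ₂ hα hherm hx hu a.1 ha.1).prod isCompact_univ

end HSide

end Literature.NumberTheory.Rogawski1990

end
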